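import Mathlib
import HarnessLib
import Summits.NavierStokesRegularity.NavierStokesRegularity.Theorems.PoloidalWindowDoorLrcModEntireTwistingTHPlaneOscillation
import Summits.NavierStokesRegularity.NavierStokesRegularity.Theorems.PoloidalWindowDoorLrcModEntireTwistingTHSlopeSign
import Summits.NavierStokesRegularity.NavierStokesRegularity.Theorems.PoloidalWindowDoorLrcModEntireTwistingTHFlatRidgeThirdJet
import Summits.NavierStokesRegularity.NavierStokesRegularity.Theorems.PoloidalWindowDoorLrcModEntireTwistingTHFlatRidgeQuarticLawTools

/-!
# Item `LrcModEntire` (stmt-NavierStokesRegularity-20428) — THE FLAT SUB-CELL: the fourth-order DYNAMIC identity `∂_ν²(∂ₜv₂)(−1,y) = ∂_ν²(Δv₂(−1,·))(y) = ρ₀·∂_ν²(Δₕv₂(−1,·))(y)`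
# at a flat hot point, for every HORIZONTAL direction `ν`

ns-k2-port-2 g7, helper of item 20428 under LEAD ns-poloidal-K2-p3 g15 (`--supports stmt-NavierStokesRegularity-20428 --as helper`).  Memo
`Cruxes/LrcModEntire/T2B-g15.md` §17d, first half («`∂ₙ²` of (★) on `H` kills `𝒜` and all lower jets: `∂ₙ²θ_t|_H = ∂ₙ²Δθ|_H = −24ρ₀ q`»), typed BY NAME at a single flat hot point
and for an ARBITRARY horizontal direction `ν` (no branch needed):

1. the doubled weight source `2𝒜 = 2(1−μ)f₂ − 2(μ_t − μ_zz)v₂ − μ_z v₂² + 4μ_z∂₂v₂` of the (TH) column is CONSTANT on the thread plane `P₀`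
   (`…TwistingTHPlaneOscillation.weightSource_eq_of_height_eq`; slope function near `P₀` from `…TwistingTHSlopeFunction.exists_slopeFunction_near_plane`, `μ₀ ≤ 0` by
   `…TwistingTHSlopeSign.slopeFunction_nonpos`), its coefficients depend on the height only, and at a flat hot point the line 2-jets of `v₂`, `v₂²`, `∂₂v₂` vanish
   (`…FlatRidgeThirdJet`) ⇒ the second horizontal derivative of the vertical residual `f₂ = (∂ₜv + (v·∇)v − Δv)₂` vanishes at `y`;
2. the convective term `Σᵢ vᵢ∂ᵢv₂` has vanishing horizontal-line 2-jet at `y` (each `∂ᵢv₂` vanishes to second order);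
3. on `P₀` the slice law gives `Δv₂ = (1 − μ₀)Δₕv₂` (`…QuarticLawTools.laplacian_two_eq_rho_mul_horiz_of_plane`).

* `lineJets_partial_of_flatHotPoint`, `iteratedDeriv_two_convect_line_eq_zero_of_flatHotPoint` — steps of 2;
* ★ `secondDeriv_timeDeriv_eq_secondDeriv_laplacian_of_flatHotPoint` — **`D²(∂ₜv₂(−1,·))(y)[ν,ν] = D²(Δv₂(−1,·))(y)[ν,ν]`** (`ν₂ = 0`);
* ★ `secondDeriv_laplacian_eq_rho_mul_horiz_of_flatHotPoint` — **`∃ ρ₀ ≥ 1, D²(Δv₂(−1,·))(y)[ν,ν] = ρ₀·D²(Δₕv₂(−1,·))(y)[ν,ν]`**.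
With `…FlatRidgeQuarticPin` (`3b² ≤ (σθ_tt − 3|N|/4)·σ∂_ν⁴θ`, `b = ∂_ν²θ_t`) this gives the memo's `72ρ₀²q ≤ 3N/4 − θ_tt` as soon as `∂_ν²Δₕθ = ∂_ν⁴θ` (normal direction of a
`C²` flat hot branch) — that last step is NOT taken here.

WHAT THIS IS NOT: not a claim about Navier–Stokes regularity and not a proof of `stub_T2bFlat`; fourth-order point identities for the OPEN flat sub-cell (bears_on LADDER-NS N0,
item 20428 / crux 19708; OPEN).
-/

set_option linter.style.longLine false
set_option linter.dupNamespace false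

namespace Summit.NavierStokesRegularity.NavierStokesRegularity.Theorems.PoloidalWindowDoorLrcModEntireTwistingTHFlatRidgeQuarticLaw

open Set Function Filter Topology Metric
open scoped RealInnerProductSpace InnerProductSpace ContDiff Laplacian
open Literature.Analysis Literature.Analysis.FluidPDE Literature.Analysis.UnboundedOperators
open Summit.NavierStokesRegularity.NavierStokesRegularity.Theorems
open Summit.NavierStokesRegularity.NavierStokesRegularity.Theorems.LocalSineTubeDoorProfileAlignedWindowRigidityAncient
open Summit.NavierStokesRegularity.NavierStokesRegularity.Theorems.PoloidalWindowDoorPoloidalWindowRigidityWindow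
open Summit.NavierStokesRegularity.NavierStokesRegularity.Theorems.PoloidalWindowDoorPoloidalWindowRigidityConstantShearSlice
open Summit.NavierStokesRegularity.NavierStokesRegularity.Theorems.PoloidalWindowDoorPoloidalWindowRigidityMaterialLeibniz
open Summit.NavierStokesRegularity.NavierStokesRegularity.Theorems.PoloidalWindowDoorLrcModEntireRidgeWiring
open Summit.NavierStokesRegularity.NavierStokesRegularity.Theorems.PoloidalWindowDoorLrcModEntireThreadPins
open Summit.NavierStokesRegularity.NavierStokesRegularity.Theorems.PoloidalWindowDoorLrcModEntireTwistingTHSlopeFunction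
open Summit.NavierStokesRegularity.NavierStokesRegularity.Theorems.PoloidalWindowDoorLrcModEntireTwistingTHSlopeSign
open Summit.NavierStokesRegularity.NavierStokesRegularity.Theorems.PoloidalWindowDoorLrcModEntireTwistingTHNonflatPlane
open Summit.NavierStokesRegularity.NavierStokesRegularity.Theorems.PoloidalWindowDoorLrcModEntireTwistingTHHotPointPins
open Summit.NavierStokesRegularity.NavierStokesRegularity.Theorems.PoloidalWindowDoorLrcModEntireTwistingTHPlaneOscillation
open Summit.NavierStokesRegularity.NavierStokesRegularity.Theorems.PoloidalWindowDoorLrcModEntireTwistingTHFlatRidgeJet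
open Summit.NavierStokesRegularity.NavierStokesRegularity.Theorems.PoloidalWindowDoorLrcModEntireTwistingTHFlatRidgeThirdJet
open Summit.NavierStokesRegularity.NavierStokesRegularity.Theorems.PoloidalWindowDoorLrcModEntireTwistingTHFlatRidgeQuarticLawTools

variable {C : ℝ} {v : ℝ → EuclideanSpace ℝ (Fin 3) → EuclideanSpace ℝ (Fin 3)}

/-- Along a line through a flat hot point `y`, every partial derivative `s ↦ ∂ₑv₂(−1, y + sν)` has vanishing `0`-, `1`-, `2`-jets at `s = 0`. -/
theorem lineJets_partial_of_flatHotPoint (hdec : HasTypeITimeDecay C v) (hcont : ContinuousOn (uncurry v) (Iio (0 : ℝ) ×ˢ univ))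
    (hmild : ∀ s t : ℝ, s < t → t < 0 → ∀ x, v t x = heatExtension (v s) (t - s) x - oseenDuhamel 1 s v v t x)
    (hdiv : ∀ t < 0, VectorCalculus.IsDivFree (v t))
    (hTH : ∀ t < 0, ∀ x x' : EuclideanSpace ℝ (Fin 3), x 2 = x' 2 → ∀ b c : Fin 3, b ≠ 2 → c ≠ 2 →
      fderiv ℝ (v t) x (EuclideanSpace.single 2 1) b * fderiv ℝ (v t) x' (EuclideanSpace.single c 1) 2 =
        fderiv ℝ (v t) x' (EuclideanSpace.single 2 1) c * fderiv ℝ (v t) x (EuclideanSpace.single b 1) 2)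
    (hne : v (-1) 0 2 ≠ 0) (hhot : ∀ t < 0, ∀ x, Real.sqrt (-t) * |v t x 2| ≤ |v (-1) 0 2|)
    (hproper : ∀ y ∈ {y : EuclideanSpace ℝ (Fin 3) | y 2 = 0 ∧ v (-1) y 2 = v (-1) 0 2}, ∀ r : ℝ, 0 < r →
      ∃ y' : EuclideanSpace ℝ (Fin 3), y' 2 = 0 ∧ dist y' y < r ∧ v (-1) y' 2 ≠ v (-1) 0 2)
    {σ : ℝ} (hσN : σ * v (-1) 0 2 = |v (-1) 0 2|)
    {y : EuclideanSpace ℝ (Fin 3)} (hy0 : y 2 = 0) (hy : v (-1) y 2 = v (-1) 0 2)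
    (hflat : fderiv ℝ (fderiv ℝ (fun x => σ * v (-1) x 2)) y (EuclideanSpace.single 0 1) (EuclideanSpace.single 0 1) +
      fderiv ℝ (fderiv ℝ (fun x => σ * v (-1) x 2)) y (EuclideanSpace.single 1 1) (EuclideanSpace.single 1 1) = 0)
    (ν e : EuclideanSpace ℝ (Fin 3)) :
    fderiv ℝ (fun x => (v (-1) x 2 : ℝ)) y e = 0 ∧
      deriv (fun s : ℝ => fderiv ℝ (fun x => (v (-1) x 2 : ℝ)) (y + s • ν) e) 0 = 0 ∧
      deriv (deriv (fun s : ℝ => fderiv ℝ (fun x => (v (-1) x 2 : ℝ)) (y + s • ν) e)) 0 = 0 := by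
  have h1 : (-1 : ℝ) < 0 := by norm_num
  set θ : EuclideanSpace ℝ (Fin 3) → ℝ := fun x => v (-1) x 2 with hθdef
  have hθ : ContDiff ℝ 3 θ := contDiff_two_component hdec hcont hmild
  have hF : ContDiff ℝ 2 (fun x => fderiv ℝ θ x e) := (hθ.fderiv_right (m := 2) (by norm_num)).clm_apply contDiff_const
  have hFd : Differentiable ℝ (fun x => fderiv ℝ θ x e) := hF.differentiable (by norm_num)
  have hvd : Differentiable ℝ (v (-1)) :=
    ((isTypeIAncientMild_of_class hdec hcont hmild hdiv).contDiff_slice h1).differentiable (by simp)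
  have hH := hessian_two_eq_zero_of_flatHotPoint hdec hcont hmild hdiv hTH hne hhot hproper hσN hy0 hy hflat
  have h3 := thirdDeriv_two_eq_zero_of_flatHotPoint hdec hcont hmild hdiv hTH hne hhot hproper hσN hy0 hy hflat
  refine ⟨?_, ?_, ?_⟩
  · rw [hθdef, fderiv_apply_coord (v (-1)) (hvd y) e 2]
    exact gradPin_of_hotPoint hdec hcont hmild hdiv hhot hy e
  · rw [deriv_line_apply hFd y ν 0, zero_smul, add_zero, ← fderiv_fderiv_eq_coord (hθ.of_le (by norm_num)) y ν e, hH]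
    simp
  · have h := iteratedDeriv_two_line_apply hF y ν
    rw [iteratedDeriv_succ, iteratedDeriv_one] at h
    rw [h, fderiv_fderiv_fderiv_apply_eq hθ y ν ν e, h3]
    simp

/-- **The convective term has vanishing horizontal-line 2-jet at a flat hot point:** `d²/ds²|₀ [D(v₂(−1,·))(y + sν)[v(−1, y + sν)]] = 0` (any direction `ν`). -/
theorem iteratedDeriv_two_convect_line_eq_zero_of_flatHotPoint (hdec : HasTypeITimeDecay C v) (hcont : ContinuousOn (uncurry v) (Iio (0 : ℝ) ×ˢ univ))
    (hmild : ∀ s t : ℝ, s < t → t < 0 → ∀ x, v t x = heatExtension (v s) (t - s) x - oseenDuhamel 1 s v v t x)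
    (hdiv : ∀ t < 0, VectorCalculus.IsDivFree (v t))
    (hTH : ∀ t < 0, ∀ x x' : EuclideanSpace ℝ (Fin 3), x 2 = x' 2 → ∀ b c : Fin 3, b ≠ 2 → c ≠ 2 →
      fderiv ℝ (v t) x (EuclideanSpace.single 2 1) b * fderiv ℝ (v t) x' (EuclideanSpace.single c 1) 2 =
        fderiv ℝ (v t) x' (EuclideanSpace.single 2 1) c * fderiv ℝ (v t) x (EuclideanSpace.single b 1) 2)
    (hne : v (-1) 0 2 ≠ 0) (hhot : ∀ t < 0, ∀ x, Real.sqrt (-t) * |v t x 2| ≤ |v (-1) 0 2|)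
    (hproper : ∀ y ∈ {y : EuclideanSpace ℝ (Fin 3) | y 2 = 0 ∧ v (-1) y 2 = v (-1) 0 2}, ∀ r : ℝ, 0 < r →
      ∃ y' : EuclideanSpace ℝ (Fin 3), y' 2 = 0 ∧ dist y' y < r ∧ v (-1) y' 2 ≠ v (-1) 0 2)
    {σ : ℝ} (hσN : σ * v (-1) 0 2 = |v (-1) 0 2|)
    {y : EuclideanSpace ℝ (Fin 3)} (hy0 : y 2 = 0) (hy : v (-1) y 2 = v (-1) 0 2)
    (hflat : fderiv ℝ (fderiv ℝ (fun x => σ * v (-1) x 2)) y (EuclideanSpace.single 0 1) (EuclideanSpace.single 0 1) +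
      fderiv ℝ (fderiv ℝ (fun x => σ * v (-1) x 2)) y (EuclideanSpace.single 1 1) (EuclideanSpace.single 1 1) = 0)
    (ν : EuclideanSpace ℝ (Fin 3)) :
    iteratedDeriv 2 (fun s : ℝ => fderiv ℝ (fun x => (v (-1) x 2 : ℝ)) (y + s • ν) (v (-1) (y + s • ν))) 0 = 0 := by
  have h1 : (-1 : ℝ) < 0 := by norm_num
  set θ : EuclideanSpace ℝ (Fin 3) → ℝ := fun x => v (-1) x 2 with hθdef
  have hθ : ContDiff ℝ 3 θ := contDiff_two_component hdec hcont hmild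
  have hs : ContDiff ℝ ∞ (v (-1)) := (isTypeIAncientMild_of_class hdec hcont hmild hdiv).contDiff_slice h1
  have hline : ContDiff ℝ ∞ (fun s : ℝ => y + s • ν) := contDiff_const.add (contDiff_id.smul contDiff_const)
  -- `Dθ(x)[v(x)] = Σᵢ vᵢ(x) ∂ᵢθ(x)`
  have hsum : (fun s : ℝ => fderiv ℝ θ (y + s • ν) (v (-1) (y + s • ν))) =
      fun s => v (-1) (y + s • ν) 0 * fderiv ℝ θ (y + s • ν) (EuclideanSpace.single 0 1) +
        v (-1) (y + s • ν) 1 * fderiv ℝ θ (y + s • ν) (EuclideanSpace.single 1 1) +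
        v (-1) (y + s • ν) 2 * fderiv ℝ θ (y + s • ν) (EuclideanSpace.single 2 1) := by
    funext s
    rw [fderiv_apply_eq_sum_coord (G := θ) (x := y + s • ν) (v (-1) (y + s • ν)), Fin.sum_univ_three]
  rw [hsum]
  have hfi : ∀ i : Fin 3, ContDiff ℝ 2 (fun s : ℝ => v (-1) (y + s • ν) i) := fun i =>
    (((EuclideanSpace.proj (𝕜 := ℝ) i).contDiff.comp hs).comp hline).of_le (by exact WithTop.coe_le_coe.2 le_top)
  have hgi : ∀ i : Fin 3, ContDiff ℝ 2 (fun s : ℝ => fderiv ℝ θ (y + s • ν) (EuclideanSpace.single i 1)) := fun i =>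
    ((hθ.fderiv_right (m := 2) (by norm_num)).clm_apply contDiff_const).comp (hline.of_le (by exact WithTop.coe_le_coe.2 le_top))
  have hzero : ∀ i : Fin 3, iteratedDeriv 2 (fun s : ℝ => v (-1) (y + s • ν) i * fderiv ℝ θ (y + s • ν) (EuclideanSpace.single i 1)) 0 = 0 := by
    intro i
    obtain ⟨h0, hd1, hd2⟩ := lineJets_partial_of_flatHotPoint hdec hcont hmild hdiv hTH hne hhot hproper hσN hy0 hy hflat ν (EuclideanSpace.single i 1)
    rw [iteratedDeriv_two_mul_eq (hfi i) (hgi i), hd1, hd2]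
    have h0' : fderiv ℝ θ (y + (0 : ℝ) • ν) (EuclideanSpace.single i 1) = 0 := by rw [zero_smul, add_zero]; exact h0
    rw [h0']
    ring
  have hp : ∀ i : Fin 3, ContDiffAt ℝ 2 (fun s : ℝ => v (-1) (y + s • ν) i * fderiv ℝ θ (y + s • ν) (EuclideanSpace.single i 1)) 0 :=
    fun i => ((hfi i).mul (hgi i)).contDiffAt
  rw [iteratedDeriv_fun_add ((hp 0).add (hp 1)) (hp 2), iteratedDeriv_fun_add (hp 0) (hp 1), hzero 0, hzero 1, hzero 2]
  ring

/-- **The vertical residual `f₂ = (∂ₜv + (v·∇)v − Δv)₂` has vanishing horizontal-line 2-jet at a flat hot point** (the doubled weight source of the (TH) column is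
constant on `P₀` with height-only coefficients; the line 2-jets of `v₂`, `v₂²`, `∂₂v₂` vanish; `1 − μ₀ > 0`). -/
theorem iteratedDeriv_two_residual_line_eq_zero_of_flatHotPoint (hdec : HasTypeITimeDecay C v) (hcont : ContinuousOn (uncurry v) (Iio (0 : ℝ) ×ˢ univ))
    (hmild : ∀ s t : ℝ, s < t → t < 0 → ∀ x, v t x = heatExtension (v s) (t - s) x - oseenDuhamel 1 s v v t x)
    (hdiv : ∀ t < 0, VectorCalculus.IsDivFree (v t))
    (hpol : ∀ s < 0, ∀ y, ⟪curl (v s) y, EuclideanSpace.single 2 1⟫_ℝ = 0)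
    (hTH : ∀ t < 0, ∀ x x' : EuclideanSpace ℝ (Fin 3), x 2 = x' 2 → ∀ b c : Fin 3, b ≠ 2 → c ≠ 2 →
      fderiv ℝ (v t) x (EuclideanSpace.single 2 1) b * fderiv ℝ (v t) x' (EuclideanSpace.single c 1) 2 =
        fderiv ℝ (v t) x' (EuclideanSpace.single 2 1) c * fderiv ℝ (v t) x (EuclideanSpace.single b 1) 2)
    (hne : v (-1) 0 2 ≠ 0) (hhot : ∀ t < 0, ∀ x, Real.sqrt (-t) * |v t x 2| ≤ |v (-1) 0 2|)
    (hproper : ∀ y ∈ {y : EuclideanSpace ℝ (Fin 3) | y 2 = 0 ∧ v (-1) y 2 = v (-1) 0 2}, ∀ r : ℝ, 0 < r →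
      ∃ y' : EuclideanSpace ℝ (Fin 3), y' 2 = 0 ∧ dist y' y < r ∧ v (-1) y' 2 ≠ v (-1) 0 2)
    {σ : ℝ} (hσN : σ * v (-1) 0 2 = |v (-1) 0 2|)
    {y : EuclideanSpace ℝ (Fin 3)} (hy0 : y 2 = 0) (hy : v (-1) y 2 = v (-1) 0 2)
    (hflat : fderiv ℝ (fderiv ℝ (fun x => σ * v (-1) x 2)) y (EuclideanSpace.single 0 1) (EuclideanSpace.single 0 1) +
      fderiv ℝ (fderiv ℝ (fun x => σ * v (-1) x 2)) y (EuclideanSpace.single 1 1) (EuclideanSpace.single 1 1) = 0)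
    {ν : EuclideanSpace ℝ (Fin 3)} (hν : ν 2 = 0) :
    iteratedDeriv 2 (fun s : ℝ => (timeDerivWithin (Iio 0) v (-1) (y + s • ν) + convect (v (-1)) (v (-1)) (y + s • ν) - Δ (v (-1)) (y + s • ν)) 2) 0 = 0 := by
  have h1 : (-1 : ℝ) < 0 := by norm_num
  have hA : IsTypeIAncientMild C v := isTypeIAncientMild_of_class hdec hcont hmild hdiv
  have hs : ContDiff ℝ ∞ (v (-1)) := hA.contDiff_slice h1
  have hsd : Differentiable ℝ (v (-1)) := hs.differentiable (by simp)
  have hθ : ContDiff ℝ ∞ (fun x => (v (-1) x 2 : ℝ)) := contDiff_two_component hdec hcont hmild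
  have hθ2 : ContDiff ℝ 2 (fun x => (v (-1) x 2 : ℝ)) := hθ.of_le (by exact WithTop.coe_le_coe.2 le_top)
  have hline : ContDiff ℝ ∞ (fun s : ℝ => y + s • ν) := contDiff_const.add (contDiff_id.smul contDiff_const)
  have hplane : ∀ s : ℝ, (y + s • ν) 2 = 0 := fun s => by simp [hy0, hν]
  -- ## the slope function near the plane `P₀` and its sign
  have h02 : (0 : EuclideanSpace ℝ (Fin 3)) 2 = 0 := rfl
  obtain ⟨y', hy'2, -, hy'ne⟩ := hproper 0 ⟨h02, rfl⟩ 1 one_pos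
  obtain ⟨y₁, hy₁, c₁, hc₁, hne₁⟩ := exists_fderiv_two_ne_zero_of_properRidge hsd ⟨y', hy'2, hy'ne⟩
  obtain ⟨μ, hμ3, hslope, -⟩ := exists_slopeFunction_near_plane hdec hcont hmild hTH hy₁ hc₁ hne₁
  have hμ0 : μ (-1) 0 ≤ 0 := slopeFunction_nonpos hdec hcont hmild hdiv hpol hne hhot hμ3.continuous (hslope 0 h02)
  -- ## names for the residual, the vertical shear entry and the plane constants
  obtain ⟨R, hR⟩ : ∃ R : EuclideanSpace ℝ (Fin 3) → ℝ,
      R = fun x => (timeDerivWithin (Iio 0) v (-1) x + convect (v (-1)) (v (-1)) x - Δ (v (-1)) x) 2 := ⟨_, rfl⟩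
  obtain ⟨E2, hE2⟩ : ∃ E2 : EuclideanSpace ℝ (Fin 3) → ℝ, E2 = fun x => fderiv ℝ (v (-1)) x (EuclideanSpace.single 2 1) 2 := ⟨_, rfl⟩
  obtain ⟨θ, hθdef⟩ : ∃ θ : EuclideanSpace ℝ (Fin 3) → ℝ, θ = fun x => (v (-1) x 2 : ℝ) := ⟨_, rfl⟩
  obtain ⟨ρ₀, hρ₀⟩ : ∃ ρ₀ : ℝ, ρ₀ = 1 - μ (-1) 0 := ⟨_, rfl⟩
  obtain ⟨m₁, hm₁⟩ : ∃ m₁ : ℝ, m₁ = deriv (fun s => μ s 0) (-1) - deriv (deriv (μ (-1))) 0 := ⟨_, rfl⟩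
  obtain ⟨m₂, hm₂⟩ : ∃ m₂ : ℝ, m₂ = deriv (μ (-1)) 0 := ⟨_, rfl⟩
  have hρ₀pos : 0 < ρ₀ := by rw [hρ₀]; linarith
  -- ## the doubled weight source is constant along the line `y + sν ⊂ P₀`
  have hconst : ∀ s : ℝ, 2 * ρ₀ * R (y + s • ν) - 2 * m₁ * θ (y + s • ν) - m₂ * θ (y + s • ν) ^ 2 + 4 * m₂ * E2 (y + s • ν) =
      2 * ρ₀ * R y - 2 * m₁ * θ y - m₂ * θ y ^ 2 + 4 * m₂ * E2 y := by
    intro s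
    have hxx' : (y + s • ν) 2 = y 2 := by rw [hplane s, hy0]
    have h := weightSource_eq_of_height_eq hdec hcont hmild hdiv hpol hμ3 h1 hxx' (fun w hw => hslope w (by rw [hw, hplane s]))
    rw [hplane s, hy0] at h
    rw [hR, hE2, hθdef, hρ₀, hm₁, hm₂]
    linear_combination h
  -- ## smoothness of the line functions
  have hRs : ContDiff ℝ ∞ R := by rw [hR]; exact contDiff_residual_two hdec hcont hmild hdiv
  have hE2s : ContDiff ℝ ∞ E2 := by rw [hE2]; exact contDiff_fderiv_coord hdec hcont hmild hdiv h1 (EuclideanSpace.single 2 1) 2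
  have hθs : ContDiff ℝ ∞ θ := by rw [hθdef]; exact hθ
  have c2 : ∀ {F : EuclideanSpace ℝ (Fin 3) → ℝ}, ContDiff ℝ ∞ F → ContDiff ℝ 2 (fun s : ℝ => F (y + s • ν)) := fun hF =>
    (hF.comp hline).of_le (by exact WithTop.coe_le_coe.2 le_top)
  have hLR := c2 hRs
  have hLθ := c2 hθs
  have hLE := c2 hE2s
  -- ## the 2-jets along the line of `θ`, `θ²`, `∂₂θ` vanish
  obtain ⟨hg0, -, -⟩ := lineJets_partial_of_flatHotPoint hdec hcont hmild hdiv hTH hne hhot hproper hσN hy0 hy hflat ν ν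
  have hH := hessian_two_eq_zero_of_flatHotPoint hdec hcont hmild hdiv hTH hne hhot hproper hσN hy0 hy hflat
  have hDθ : iteratedDeriv 2 (fun s : ℝ => θ (y + s • ν)) 0 = 0 := by
    rw [hθdef, iteratedDeriv_two_line_apply hθ2 y ν, hH]; simp
  have hθline1 : deriv (fun s : ℝ => θ (y + s • ν)) 0 = 0 := by
    rw [hθdef, deriv_line_apply (hθ2.differentiable (by norm_num)) y ν 0, zero_smul, add_zero]; exact hg0
  have hθline2 : deriv (deriv (fun s : ℝ => θ (y + s • ν))) 0 = 0 := by
    rw [← iteratedDeriv_one (f := fun s : ℝ => θ (y + s • ν)), ← iteratedDeriv_succ]; exact hDθ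
  have hDθsq : iteratedDeriv 2 (fun s : ℝ => θ (y + s • ν) ^ 2) 0 = 0 := by
    have e : (fun s : ℝ => θ (y + s • ν) ^ 2) = fun s => θ (y + s • ν) * θ (y + s • ν) := by funext s; ring
    rw [e, iteratedDeriv_two_mul_eq hLθ hLθ, hθline1, hθline2]
    ring
  have hDE : iteratedDeriv 2 (fun s : ℝ => E2 (y + s • ν)) 0 = 0 := by
    have eE : (fun s : ℝ => E2 (y + s • ν)) = fun s => fderiv ℝ (fun x => (v (-1) x 2 : ℝ)) (y + s • ν) (EuclideanSpace.single 2 1) := by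
      funext s; rw [hE2]; exact (fderiv_apply_coord (v (-1)) (hsd _) (EuclideanSpace.single 2 1) 2).symm
    obtain ⟨-, -, hd2⟩ := lineJets_partial_of_flatHotPoint hdec hcont hmild hdiv hTH hne hhot hproper hσN hy0 hy hflat ν (EuclideanSpace.single 2 1)
    rw [eE, iteratedDeriv_succ, iteratedDeriv_one]
    exact hd2
  -- ## differentiate the constant combination twice
  have hc : iteratedDeriv 2 (fun s : ℝ => 2 * ρ₀ * R (y + s • ν) - 2 * m₁ * θ (y + s • ν) - m₂ * θ (y + s • ν) ^ 2 + 4 * m₂ * E2 (y + s • ν)) 0 = 0 := by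
    rw [show (fun s : ℝ => 2 * ρ₀ * R (y + s • ν) - 2 * m₁ * θ (y + s • ν) - m₂ * θ (y + s • ν) ^ 2 + 4 * m₂ * E2 (y + s • ν)) =
        fun _ => 2 * ρ₀ * R y - 2 * m₁ * θ y - m₂ * θ y ^ 2 + 4 * m₂ * E2 y from funext hconst]
    simp [iteratedDeriv_succ]
  have hA' : ContDiffAt ℝ 2 (fun s : ℝ => 2 * ρ₀ * R (y + s • ν)) 0 := (contDiff_const.mul hLR).contDiffAt
  have hB' : ContDiffAt ℝ 2 (fun s : ℝ => 2 * m₁ * θ (y + s • ν)) 0 := (contDiff_const.mul hLθ).contDiffAt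
  have hC' : ContDiffAt ℝ 2 (fun s : ℝ => m₂ * θ (y + s • ν) ^ 2) 0 := (contDiff_const.mul (hLθ.pow 2)).contDiffAt
  have hD' : ContDiffAt ℝ 2 (fun s : ℝ => 4 * m₂ * E2 (y + s • ν)) 0 := (contDiff_const.mul hLE).contDiffAt
  rw [iteratedDeriv_fun_add ((hA'.sub hB').sub hC') hD', iteratedDeriv_fun_sub (hA'.sub hB') hC', iteratedDeriv_fun_sub hA' hB',
    iteratedDeriv_const_mul (2 * ρ₀) hLR.contDiffAt, iteratedDeriv_const_mul (2 * m₁) hLθ.contDiffAt,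
    iteratedDeriv_const_mul m₂ (hLθ.pow 2).contDiffAt, iteratedDeriv_const_mul (4 * m₂) hLE.contDiffAt, hDθ, hDE, hDθsq] at hc
  have h2 : 2 * ρ₀ * iteratedDeriv 2 (fun s : ℝ => R (y + s • ν)) 0 = 0 := by linarith only [hc]
  have h3 := (mul_eq_zero.1 h2).resolve_left (by positivity)
  rw [hR] at h3
  exact h3

/-- ★ **THE FOURTH-ORDER DYNAMIC IDENTITY at a flat hot point: `D²(∂ₜv₂(−1,·))(y)[ν,ν] = D²(Δv₂(−1,·))(y)[ν,ν]` for every horizontal `ν`** (clauses of `stub_T2bFlat`: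
class, poloidality, global (TH), hot-spot normalisation, «no hot plane» `hproper`, the flat law at the hot point `y ∈ P₀`). -/
theorem secondDeriv_timeDeriv_eq_secondDeriv_laplacian_of_flatHotPoint (hdec : HasTypeITimeDecay C v) (hcont : ContinuousOn (uncurry v) (Iio (0 : ℝ) ×ˢ univ))
    (hmild : ∀ s t : ℝ, s < t → t < 0 → ∀ x, v t x = heatExtension (v s) (t - s) x - oseenDuhamel 1 s v v t x)
    (hdiv : ∀ t < 0, VectorCalculus.IsDivFree (v t))
    (hpol : ∀ s < 0, ∀ y, ⟪curl (v s) y, EuclideanSpace.single 2 1⟫_ℝ = 0)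
    (hTH : ∀ t < 0, ∀ x x' : EuclideanSpace ℝ (Fin 3), x 2 = x' 2 → ∀ b c : Fin 3, b ≠ 2 → c ≠ 2 →
      fderiv ℝ (v t) x (EuclideanSpace.single 2 1) b * fderiv ℝ (v t) x' (EuclideanSpace.single c 1) 2 =
        fderiv ℝ (v t) x' (EuclideanSpace.single 2 1) c * fderiv ℝ (v t) x (EuclideanSpace.single b 1) 2)
    (hne : v (-1) 0 2 ≠ 0) (hhot : ∀ t < 0, ∀ x, Real.sqrt (-t) * |v t x 2| ≤ |v (-1) 0 2|)
    (hproper : ∀ y ∈ {y : EuclideanSpace ℝ (Fin 3) | y 2 = 0 ∧ v (-1) y 2 = v (-1) 0 2}, ∀ r : ℝ, 0 < r →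
      ∃ y' : EuclideanSpace ℝ (Fin 3), y' 2 = 0 ∧ dist y' y < r ∧ v (-1) y' 2 ≠ v (-1) 0 2)
    {σ : ℝ} (hσN : σ * v (-1) 0 2 = |v (-1) 0 2|)
    {y : EuclideanSpace ℝ (Fin 3)} (hy0 : y 2 = 0) (hy : v (-1) y 2 = v (-1) 0 2)
    (hflat : fderiv ℝ (fderiv ℝ (fun x => σ * v (-1) x 2)) y (EuclideanSpace.single 0 1) (EuclideanSpace.single 0 1) +
      fderiv ℝ (fderiv ℝ (fun x => σ * v (-1) x 2)) y (EuclideanSpace.single 1 1) (EuclideanSpace.single 1 1) = 0)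
    {ν : EuclideanSpace ℝ (Fin 3)} (hν : ν 2 = 0) :
    fderiv ℝ (fderiv ℝ (fun x => deriv (fun s => v s x 2) (-1))) y ν ν = fderiv ℝ (fderiv ℝ (Δ (fun x => (v (-1) x 2 : ℝ)))) y ν ν := by
  have hline : ContDiff ℝ ∞ (fun s : ℝ => y + s • ν) := contDiff_const.add (contDiff_id.smul contDiff_const)
  have c2 : ∀ {F : EuclideanSpace ℝ (Fin 3) → ℝ}, ContDiff ℝ ∞ F → ContDiff ℝ 2 (fun s : ℝ => F (y + s • ν)) := fun hF =>
    (hF.comp hline).of_le (by exact WithTop.coe_le_coe.2 le_top)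
  obtain ⟨hθts, hconvs, hΔs⟩ := contDiff_residual_summands hdec hcont hmild
  have hDR := iteratedDeriv_two_residual_line_eq_zero_of_flatHotPoint hdec hcont hmild hdiv hpol hTH hne hhot hproper hσN hy0 hy hflat hν
  have hRline : (fun s : ℝ => (timeDerivWithin (Iio 0) v (-1) (y + s • ν) + convect (v (-1)) (v (-1)) (y + s • ν) - Δ (v (-1)) (y + s • ν)) 2) =
      fun s => deriv (fun t => v t (y + s • ν) 2) (-1) +
        fderiv ℝ (fun x => (v (-1) x 2 : ℝ)) (y + s • ν) (v (-1) (y + s • ν)) - (Δ (fun x => (v (-1) x 2 : ℝ))) (y + s • ν) := by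
    funext s
    exact congrFun (residual_two_eq hdec hcont hmild hdiv) (y + s • ν)
  have hconv0 := iteratedDeriv_two_convect_line_eq_zero_of_flatHotPoint hdec hcont hmild hdiv hTH hne hhot hproper hσN hy0 hy hflat ν
  rw [hRline, iteratedDeriv_fun_sub ((c2 hθts).contDiffAt.add (c2 hconvs).contDiffAt) (c2 hΔs).contDiffAt,
    iteratedDeriv_fun_add (c2 hθts).contDiffAt (c2 hconvs).contDiffAt, hconv0, add_zero, sub_eq_zero,
    iteratedDeriv_two_line_apply (hθts.of_le (by exact WithTop.coe_le_coe.2 le_top)) y ν,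
    iteratedDeriv_two_line_apply (hΔs.of_le (by exact WithTop.coe_le_coe.2 le_top)) y ν] at hDR
  exact hDR

/-- ★ **`D²(Δv₂(−1,·))(y)[ν,ν] = ρ₀·D²(Δₕv₂(−1,·))(y)[ν,ν]` with `ρ₀ = 1 − μ₀ ≥ 1`** at a flat hot point, horizontal `ν` (`Δₕθ := ∂₀∂₀θ + ∂₁∂₁θ`; the slice law
`Δθ = (1 − μ₀)Δₕθ` holds on the whole thread plane `P₀`, `μ₀ ≤ 0` by `slopeFunction_nonpos`). -/
theorem secondDeriv_laplacian_eq_rho_mul_horiz_of_flatHotPoint (hdec : HasTypeITimeDecay C v) (hcont : ContinuousOn (uncurry v) (Iio (0 : ℝ) ×ˢ univ))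
    (hmild : ∀ s t : ℝ, s < t → t < 0 → ∀ x, v t x = heatExtension (v s) (t - s) x - oseenDuhamel 1 s v v t x)
    (hdiv : ∀ t < 0, VectorCalculus.IsDivFree (v t))
    (hpol : ∀ s < 0, ∀ y, ⟪curl (v s) y, EuclideanSpace.single 2 1⟫_ℝ = 0)
    (hTH : ∀ t < 0, ∀ x x' : EuclideanSpace ℝ (Fin 3), x 2 = x' 2 → ∀ b c : Fin 3, b ≠ 2 → c ≠ 2 →
      fderiv ℝ (v t) x (EuclideanSpace.single 2 1) b * fderiv ℝ (v t) x' (EuclideanSpace.single c 1) 2 =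
        fderiv ℝ (v t) x' (EuclideanSpace.single 2 1) c * fderiv ℝ (v t) x (EuclideanSpace.single b 1) 2)
    (hne : v (-1) 0 2 ≠ 0) (hhot : ∀ t < 0, ∀ x, Real.sqrt (-t) * |v t x 2| ≤ |v (-1) 0 2|)
    (hproper : ∀ y ∈ {y : EuclideanSpace ℝ (Fin 3) | y 2 = 0 ∧ v (-1) y 2 = v (-1) 0 2}, ∀ r : ℝ, 0 < r →
      ∃ y' : EuclideanSpace ℝ (Fin 3), y' 2 = 0 ∧ dist y' y < r ∧ v (-1) y' 2 ≠ v (-1) 0 2)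
    {y : EuclideanSpace ℝ (Fin 3)} (hy0 : y 2 = 0) {ν : EuclideanSpace ℝ (Fin 3)} (hν : ν 2 = 0) :
    ∃ ρ₀ : ℝ, 1 ≤ ρ₀ ∧ fderiv ℝ (fderiv ℝ (Δ (fun x => (v (-1) x 2 : ℝ)))) y ν ν =
      ρ₀ * fderiv ℝ (fderiv ℝ (fun x => fderiv ℝ (fun x' => fderiv ℝ (fun y' => (v (-1) y' 2 : ℝ)) x' (EuclideanSpace.single 0 1)) x (EuclideanSpace.single 0 1) +
        fderiv ℝ (fun x' => fderiv ℝ (fun y' => (v (-1) y' 2 : ℝ)) x' (EuclideanSpace.single 1 1)) x (EuclideanSpace.single 1 1))) y ν ν := by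
  have h1 : (-1 : ℝ) < 0 := by norm_num
  have hA : IsTypeIAncientMild C v := isTypeIAncientMild_of_class hdec hcont hmild hdiv
  have hs : ContDiff ℝ ∞ (v (-1)) := hA.contDiff_slice h1
  have hsd : Differentiable ℝ (v (-1)) := hs.differentiable (by simp)
  set θ : EuclideanSpace ℝ (Fin 3) → ℝ := fun x => v (-1) x 2 with hθdef
  have hθ : ContDiff ℝ ∞ θ := contDiff_two_component hdec hcont hmild
  have hline : ContDiff ℝ ∞ (fun s : ℝ => y + s • ν) := contDiff_const.add (contDiff_id.smul contDiff_const)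
  have hplane : ∀ s : ℝ, (y + s • ν) 2 = 0 := fun s => by simp [hy0, hν]
  -- slope on the plane `P₀` with the constant `μ₀`
  have h02 : (0 : EuclideanSpace ℝ (Fin 3)) 2 = 0 := rfl
  obtain ⟨y', hy'2, -, hy'ne⟩ := hproper 0 ⟨h02, rfl⟩ 1 one_pos
  obtain ⟨y₁, hy₁, c₁, hc₁, hne₁⟩ := exists_fderiv_two_ne_zero_of_properRidge hsd ⟨y', hy'2, hy'ne⟩
  obtain ⟨μ, hμ3, hslope, -⟩ := exists_slopeFunction_near_plane hdec hcont hmild hTH hy₁ hc₁ hne₁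
  have hμ0 : μ (-1) 0 ≤ 0 := slopeFunction_nonpos hdec hcont hmild hdiv hpol hne hhot hμ3.continuous (hslope 0 h02)
  have hslope0 : ∀ w : EuclideanSpace ℝ (Fin 3), w 2 = 0 → ∀ b : Fin 3, b ≠ 2 →
      fderiv ℝ (v (-1)) w (EuclideanSpace.single 2 (1 : ℝ)) b = μ (-1) 0 * fderiv ℝ (v (-1)) w (EuclideanSpace.single b (1 : ℝ)) 2 := by
    intro w hw b hb
    have h := (hslope w hw).self_of_nhds b hb
    simpa [hw] using h
  have hdivpt : ∀ x : EuclideanSpace ℝ (Fin 3), fderiv ℝ (v (-1)) x (EuclideanSpace.single 0 (1 : ℝ)) 0 +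
      fderiv ℝ (v (-1)) x (EuclideanSpace.single 1 (1 : ℝ)) 1 + fderiv ℝ (v (-1)) x (EuclideanSpace.single 2 (1 : ℝ)) 2 = 0 :=
    fun x => div_coord (hdiv (-1) h1) x
  -- the horizontal Laplacian and its smoothness
  set Lh : EuclideanSpace ℝ (Fin 3) → ℝ := fun x => fderiv ℝ (fun x' => fderiv ℝ θ x' (EuclideanSpace.single 0 1)) x (EuclideanSpace.single 0 1) +
    fderiv ℝ (fun x' => fderiv ℝ θ x' (EuclideanSpace.single 1 1)) x (EuclideanSpace.single 1 1) with hLh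
  have hsec : ∀ e : EuclideanSpace ℝ (Fin 3), ContDiff ℝ ∞ (fun x => fderiv ℝ (fun x' => fderiv ℝ θ x' e) x e) := fun e =>
    (((hθ.fderiv_right (m := ∞) (by norm_cast)).clm_apply contDiff_const).fderiv_right (m := ∞) (by norm_cast)).clm_apply contDiff_const
  have hLhs : ContDiff ℝ ∞ Lh := (hsec _).add (hsec _)
  have hΔs : ContDiff ℝ ∞ (Δ θ) := (contDiff_residual_summands hdec hcont hmild).2.2
  -- the slice law along the line
  have hlaw : (fun s : ℝ => (Δ θ) (y + s • ν)) = fun s => (1 - μ (-1) 0) * Lh (y + s • ν) := by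
    funext s
    exact laplacian_two_eq_rho_mul_horiz_of_plane (hs.of_le (by norm_cast)) hdivpt hslope0 (hplane s)
  refine ⟨1 - μ (-1) 0, by linarith, ?_⟩
  have hL2 : ContDiff ℝ 2 (fun s : ℝ => Lh (y + s • ν)) := (hLhs.comp hline).of_le (by exact WithTop.coe_le_coe.2 le_top)
  rw [← iteratedDeriv_two_line_apply (hΔs.of_le (by exact WithTop.coe_le_coe.2 le_top)) y ν,
    ← iteratedDeriv_two_line_apply (hLhs.of_le (by exact WithTop.coe_le_coe.2 le_top)) y ν, hlaw,
    iteratedDeriv_const_mul (1 - μ (-1) 0) hL2.contDiffAt]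

end Summit.NavierStokesRegularity.NavierStokesRegularity.Theorems.PoloidalWindowDoorLrcModEntireTwistingTHFlatRidgeQuarticLaw
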